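import Literature.Probability.Percolation.AltFourArmLiminfFromLoops
import Literature.Probability.Percolation.AltFourArmInterfaceLoops
import HarnessLib

/-!
# The alternating four-arm probabilities and the loop scaling limit: the upper direction

Topic: Probability / Percolation. Proof-only file (no definitions, no named facts) serving the
named fact `Literature.Probability.Percolation.fourArm_exponent` (S. Smirnov, W. Werner, Math.
Res. Lett. **8** (2001), Thm. 4 of arXiv `math/0109120`, `j = 4`). Smirnov–Werner derive the
exponent from (16) "`lim_ρ b_j(ρr, ρR) = b'_j(r, R)`" (a consequence of the scaling limit) and the
`SLE₆` value (9) of the continuum quantity. Along the loop-ensemble reading of (16) for `j = 4`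
(Remark 6 and (15): four crossings of the annulus by interfaces; Garban–Pete–Schramm 2013, §2.4),
the tree now has both lattice directions of the dictionary between the alternating four-arm event
`altFourArm` and shell traversals of the Camia–Newman loop collection
(`AltFourArmOfCrossingLoops.lean`: loops ⇒ arms; `AltFourArmInterfaceLoops.lean`: arms ⇒ loops) and
the portmanteau LOWER half (`AltFourArmLiminfFromLoops.lean`). This file adds the upper
direction on the lattice side, the plain portmanteau upper bound, and the reason why the plain
bound does not carry the exponent:

* `eventually_loopShellTraversal_of_mem_altFourArm` — **lattice step, upper direction**: for
  `r₁ < ρ`, `R < (√3/2) r₂` and `D ⊇ B̄(0, r₂)`, for all large `n`,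
  `altFourArm (n r₁) (n r₂) ⊆ {ω | triLoopCollection D n⁻¹ ω ∈ loopShellTraversal ρ R}`
  (`triLoopCollection_traversals_of_mem_altFourArm` at mesh `n⁻¹`, radii absorbed for large `n`);
* `eventually_altFourArmProbAt_lt_of_tendstoLaw` — **portmanteau, upper half (plain form)**:
  under convergence in law of the loop collections to `P'` (Camia–Newman), for every
  `u > P'(closure (loopShellTraversal ρ R))`, eventually `P_{1/2}(altFourArm (n r₁) (n r₂)) < u`,
  i.e. `limsup_n π̂^alt(n r₁, n r₂) ≤ P'(closure loopShellTraversal ρ R)` (Mathlib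
  `ProbabilityMeasure.limsup_measure_closed_le_of_tendsto`);
* `mem_closure_loopShellTraversal_of_cross` — **why the plain form is not sharp**: the closure of
  `loopShellTraversal ρ R` contains every collection with a member crossing the open shell (add a
  small translate of that member), so its `P'`-mass is a two-arm quantity. The sharp upper half
  of (16)₄ along this route needs, on the lattice side and before the limit, the `δ`-closeness
  estimate of Garban–Pete–Schramm (2013), §2.4 (four interface crossings pairwise `δ`-separated
  with probability `1 - ε(δ)` uniformly in the mesh, from a priori bounds on the polychromatic
  6- and 7-arm events and the half-plane 3-arm event), which the tree does not have yet; it is recorded here so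
  that the closed event of the eventual sharp statement is chosen accordingly (traversals
  separated at scale `δ`), not as `closure (loopShellTraversal ρ R)`.

No named fact is introduced.

## References

* S. Smirnov, W. Werner, *Critical exponents for two-dimensional percolation*, Math. Res. Lett. 8
  (2001) 729–744, Thm. 4, §4 (9), (12)–(16), Remark 6 [SmirnovWernerMRL2001].
* C. Garban, G. Pete, O. Schramm, J. Amer. Math. Soc. 26 (2013), §2.4 Lemma 2.9
  [GarbanPeteSchramm2013Pivotal].
* F. Camia, C. M. Newman, Comm. Math. Phys. 268 (2006), §2, Thms 1–3 [CamiaNewman2006].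
* P. Billingsley, *Convergence of probability measures*, 2nd ed. (1999), Thm 2.1 [Billingsley1999].
-/

noncomputable section

open Set Metric Complex Filter MeasureTheory
open Literature.Topology.PlaneTopology Literature.Probability.RandomPlanarGeometry
open scoped unitInterval Topology

namespace Literature.Probability.Percolation

open LatticeModels

/-! ### The lattice step, upper direction -/

/-- **Arms give shell traversals of the loop collection, eventually along the meshes `n⁻¹`.** Let
`1 ≤ r₁ ≤ r₂`, `r₁ < ρ`, `R < (√3/2) r₂`, and let the Jordan domain `D` contain the closed disc of
radius `r₂`. Then for all large `n`, for every `ω ∈ altFourArm (n r₁) (n r₂)` the loop collection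
`triLoopCollection D n⁻¹ ω` lies in `loopShellTraversal ρ R`
(`triLoopCollection_traversals_of_mem_altFourArm` at mesh `δ = n⁻¹`: the radii there are
`r₁ + 2δ ≤ ρ` and `(√3/2)(r₂ + δ) - 3δ ≥ R` once `δ` is small). [cite: SmirnovWernerMRL2001, §4 Remark 6 and (15)] [cite: GarbanPeteSchramm2013Pivotal, §2.4] -/
theorem eventually_loopShellTraversal_of_mem_altFourArm {r₁ r₂ : ℕ} {ρ R : ℝ} (hr₁ : 1 ≤ r₁) (h₁₂ : r₁ ≤ r₂)
    (h₁ : (r₁ : ℝ) < ρ) (h₂ : R < Real.sqrt 3 / 2 * r₂)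
    (D : JordanDomain) (hD : closedBall (0 : ℂ) r₂ ⊆ D.carrier) :
    ∀ᶠ n : ℕ in atTop, ∀ ω : SiteConfig (Site 2),
      ω ∈ altFourArm (n * r₁) (n * r₂) → triLoopCollection D (n : ℝ)⁻¹ ω ∈ loopShellTraversal ρ R := by
  set g : ℝ := min ((ρ - r₁) / 2) ((Real.sqrt 3 / 2 * r₂ - R) / 3) with hg
  have hgpos : 0 < g := lt_min (by linarith) (by linarith)
  have hg1 : g ≤ (ρ - r₁) / 2 := min_le_left _ _
  have hg2 : g ≤ (Real.sqrt 3 / 2 * r₂ - R) / 3 := min_le_right _ _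
  have hδev : ∀ᶠ n : ℕ in atTop, (n : ℝ)⁻¹ ≤ g ∧ 1 ≤ n := by
    have h1 : ∀ᶠ n : ℕ in atTop, (n : ℝ)⁻¹ ≤ g :=
      (tendsto_inv_natCast_nhdsGT_zero.mono_right nhdsWithin_le_nhds).eventually (ge_mem_nhds hgpos)
    exact h1.and (eventually_ge_atTop 1)
  filter_upwards [hδev] with n ⟨hδg, hn1⟩ ω hω
  set δ : ℝ := (n : ℝ)⁻¹ with hδdef
  have hnpos : (0 : ℝ) < n := by exact_mod_cast hn1
  have hδ : 0 < δ := inv_pos.2 hnpos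
  have hδn : δ * n = 1 := inv_mul_cancel₀ hnpos.ne'
  have hδr₁ : δ * ((n * r₁ : ℕ) : ℝ) = r₁ := by push_cast; rw [← mul_assoc, hδn, one_mul]
  have hδr₂ : δ * ((n * r₂ : ℕ) : ℝ) = r₂ := by push_cast; rw [← mul_assoc, hδn, one_mul]
  have hs0 : 0 ≤ Real.sqrt 3 / 2 * δ := by positivity
  -- the radii of `triLoopCollection_traversals_of_mem_altFourArm` against `ρ`, `R`
  have hin₁ : δ * ((n * r₁ : ℕ) : ℝ) + 2 * δ ≤ ρ := by rw [hδr₁]; linarith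
  have hin₂ : δ * ((n * r₁ : ℕ) : ℝ) ≤ ρ := by rw [hδr₁]; linarith
  have hout₁ : R ≤ Real.sqrt 3 / 2 * δ * (((n * r₂ : ℕ) : ℝ) + 1) - δ - 2 * δ := by
    have : Real.sqrt 3 / 2 * δ * (((n * r₂ : ℕ) : ℝ) + 1) = Real.sqrt 3 / 2 * r₂ + Real.sqrt 3 / 2 * δ := by
      rw [mul_add, mul_one, mul_assoc, hδr₂]
    rw [this]; linarith
  have hout₂ : R ≤ Real.sqrt 3 / 2 * δ * (((n * r₂ : ℕ) : ℝ) + 1) - δ := by linarith [hδ.le]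
  have hr : 1 ≤ n * r₁ := Nat.mul_le_mul hn1 hr₁
  have hrR : n * r₁ ≤ n * r₂ := Nat.mul_le_mul_left n h₁₂
  have hD' : closedBall (0 : ℂ) (δ * ((n * r₂ : ℕ) : ℝ)) ⊆ D.carrier := by rwa [hδr₂]
  rcases triLoopCollection_traversals_of_mem_altFourArm hr hrR hω hδ D hD' with
    ⟨γ, hγ, htr⟩ | ⟨c₁, hc₁, c₂, hc₂, hne, h₁', h₂'⟩
  · exact Or.inl ⟨γ, hγ, htr.mono' hin₁ hout₁⟩
  · exact Or.inr ⟨c₁, hc₁, c₂, hc₂, hne, rangeCross_mono hin₂ hout₂ h₁', rangeCross_mono hin₂ hout₂ h₂'⟩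

/-! ### The portmanteau upper bound -/

/-- **The alternating four-arm probabilities are eventually bounded above by the loop scaling
limit.** Let `1 ≤ r₁ ≤ r₂`, `r₁ < ρ`, `R < (√3/2) r₂`, let the Jordan domain `D` contain the closed
disc of radius `r₂`, and let the loop collections `triLoopCollection D δ` of critical site
percolation converge in law, as the mesh `δ → 0⁺`, to a probability law `P'` on `LoopSpace ℂ`
(Camia–Newman; `exists_isCNLFamily_tendsto`). Then for every
`u > P'(closure (loopShellTraversal ρ R))`, for all large `n`,
`P_{1/2}(altFourArm (n r₁) (n r₂)) < u`; that is,
`limsup_n π̂^alt(n r₁, n r₂) ≤ P'(closure loopShellTraversal ρ R)` — the upper half of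
Smirnov–Werner's (16) for the alternating four-arm event in portmanteau form (Mathlib
`ProbabilityMeasure.limsup_measure_closed_le_of_tendsto`) with the lattice step
`eventually_loopShellTraversal_of_mem_altFourArm`. [cite: SmirnovWernerMRL2001, §4 (16)] [cite: GarbanPeteSchramm2013Pivotal, §2.4] [cite: Billingsley1999, Thm 2.1] -/
theorem eventually_altFourArmProbAt_lt_of_tendstoLaw {r₁ r₂ : ℕ} {ρ R : ℝ} (hr₁ : 1 ≤ r₁) (h₁₂ : r₁ ≤ r₂)
    (h₁ : (r₁ : ℝ) < ρ) (h₂ : R < Real.sqrt 3 / 2 * r₂)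
    (D : JordanDomain) (hD : closedBall (0 : ℂ) r₂ ⊆ D.carrier)
    {P' : Measure (LoopSpace ℂ)} [IsProbabilityMeasure P']
    (hconv : TendstoLaw (Ωδ := fun _ ↦ SiteConfig (Site 2)) (fun δ ↦ triLoopCollection D δ)
      (fun _ ↦ triSitePercolation half) id P')
    {u : ℝ} (hu : P'.real (closure (loopShellTraversal ρ R)) < u) :
    ∀ᶠ n : ℕ in atTop, altFourArmProbAt half (n * r₁) (n * r₂) < u := by
  set C : Set (LoopSpace ℂ) := closure (loopShellTraversal ρ R) with hC
  have hT : Tendsto (triLoopLaw D) (𝓝[>] 0) (𝓝 ⟨P', inferInstance⟩) :=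
    (tendstoLaw_iff_tendsto_triLoopLaw D).1 hconv
  have h1 : P' C < ENNReal.ofReal u := (ENNReal.lt_ofReal_iff_toReal_lt (measure_ne_top _ _)).2 hu
  have hport := ProbabilityMeasure.limsup_measure_closed_le_of_tendsto hT (isClosed_closure : IsClosed C)
  have h3 := Filter.eventually_lt_of_limsup_lt (hport.trans_lt h1)
  have h4 := tendsto_inv_natCast_nhdsGT_zero.eventually h3
  filter_upwards [h4, eventually_loopShellTraversal_of_mem_altFourArm hr₁ h₁₂ h₁ h₂ D hD, eventually_ge_atTop 1]
    with n hn hincl hn1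
  have hδpos : (0 : ℝ) < (n : ℝ)⁻¹ := inv_pos.2 (by exact_mod_cast hn1)
  rw [triLoopLaw_apply hδpos isClosed_closure.measurableSet] at hn
  have hsub : altFourArm (n * r₁) (n * r₂) ⊆ {ω | triLoopCollection D (n : ℝ)⁻¹ ω ∈ C} :=
    fun ω hω ↦ subset_closure (hincl ω hω)
  exact ENNReal.toReal_lt_of_lt_ofReal ((measure_mono hsub).trans_lt hn)

/-! ### The closure of the traversal event is large -/

/-- **The plain portmanteau upper bound is not sharp: the closure of the shell-traversal event
contains every collection with a member crossing the open shell.** If some member `c ∈ L` has a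
point of norm `< ρ` and a point of norm `> R`, then `L ∈ closure (loopShellTraversal ρ R)`:
adding to `L` a small translate of `c` (a class with a different trace, also crossing) gives
members of the event converging to `L` in the Hausdorff distance. Under the Camia–Newman limit
the right-hand side of `eventually_altFourArmProbAt_lt_of_tendstoLaw` is therefore at least a
TWO-arm quantity (exponent `1/4`, not `5/4`): along this route the sharp upper half of
Smirnov–Werner's (16) for `j = 4` needs, before passing to the limit, that the four interface
crossings can be chosen pairwise macroscopically separated with high probability — the
`δ`-closeness estimate of Garban–Pete–Schramm (2013), §2.4 (proof of Lemma 2.9: a priori bounds for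
the polychromatic 6- and 7-arm events and the half-plane 3-arm event). [cite: GarbanPeteSchramm2013Pivotal, §2.4 Lemma 2.9] [cite: SmirnovWernerMRL2001, §4 (16)] -/
theorem mem_closure_loopShellTraversal_of_cross {ρ R : ℝ} {L : LoopSpace ℂ} {c : CurveClass ℂ} (hc : c ∈ L)
    (hin : ∃ z ∈ CurveClass.range c, ‖z‖ < ρ) (hout : ∃ z ∈ CurveClass.range c, R < ‖z‖) :
    L ∈ closure (loopShellTraversal ρ R) := by
  obtain ⟨z₁, hz₁, hz₁ρ⟩ := hin
  obtain ⟨z₂, hz₂, hz₂R⟩ := hout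
  obtain ⟨γ, rfl⟩ := CurveClass.surjective_mk c
  rw [CurveClass.range_mk] at hz₁ hz₂
  rw [EMetric.mem_closure_iff]
  intro ε hε
  -- a real `η > 0` below `ε`
  obtain ⟨η, hη, hηε⟩ : ∃ η : ℝ, 0 < η ∧ ENNReal.ofReal η < ε := by
    rcases eq_or_ne ε ⊤ with h | h
    · exact ⟨1, one_pos, h ▸ ENNReal.ofReal_lt_top⟩
    · have hε' : 0 < ε.toReal := ENNReal.toReal_pos hε.ne' h
      refine ⟨ε.toReal / 2, by positivity, ?_⟩
      calc ENNReal.ofReal (ε.toReal / 2) < ENNReal.ofReal ε.toReal :=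
            (ENNReal.ofReal_lt_ofReal_iff hε').2 (by linarith)
        _ = ε := ENNReal.ofReal_toReal h
  -- the translation
  set m : ℝ := min (ρ - ‖z₁‖) (‖z₂‖ - R) with hm
  have hmpos : 0 < m := lt_min (by linarith) (by linarith)
  set v : ℝ := min (η / 2) (m / 2) with hv
  have hvpos : 0 < v := lt_min (by positivity) (by positivity)
  have hvη : v ≤ η / 2 := min_le_left _ _
  have hvm : v ≤ m / 2 := min_le_right _ _
  set f : C(ℂ, ℂ) := ⟨fun z ↦ z + (v : ℂ), by fun_prop⟩ with hf
  set c' : CurveClass ℂ := CurveClass.map f (CurveClass.mk γ) with hc'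
  have hrange' : CurveClass.range c' = (fun z ↦ z + (v : ℂ)) '' γ.range := by
    rw [hc', CurveClass.range_map, CurveClass.range_mk]; rfl
  -- the traces differ: the real part of the translate's trace exceeds the maximum on the trace
  have hne : CurveClass.range (CurveClass.mk γ) ≠ CurveClass.range c' := by
    rw [CurveClass.range_mk, hrange']
    intro heq
    obtain ⟨w, hw, hmax⟩ := γ.isCompact_range.exists_isMaxOn ⟨z₁, hz₁⟩ Complex.continuous_re.continuousOn
    have hw' : w + (v : ℂ) ∈ γ.range := by rw [heq]; exact ⟨w, hw, rfl⟩
    have h2 : (w + (v : ℂ)).re ≤ w.re := hmax hw'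
    rw [Complex.add_re, Complex.ofReal_re] at h2
    linarith
  -- both cross the closed shell
  have hcross : (∃ z ∈ CurveClass.range (CurveClass.mk γ), ‖z‖ ≤ ρ) ∧
      ∃ z ∈ CurveClass.range (CurveClass.mk γ), R ≤ ‖z‖ := by
    rw [CurveClass.range_mk]
    exact ⟨⟨z₁, hz₁, hz₁ρ.le⟩, z₂, hz₂, hz₂R.le⟩
  have hm1 : m ≤ ρ - ‖z₁‖ := min_le_left _ _
  have hm2 : m ≤ ‖z₂‖ - R := min_le_right _ _
  have hnv : ‖(v : ℂ)‖ = v := by rw [Complex.norm_real, Real.norm_of_nonneg hvpos.le]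
  have hcross' : (∃ z ∈ CurveClass.range c', ‖z‖ ≤ ρ) ∧ ∃ z ∈ CurveClass.range c', R ≤ ‖z‖ := by
    rw [hrange']
    refine ⟨⟨z₁ + v, ⟨z₁, hz₁, rfl⟩, ?_⟩, z₂ + v, ⟨z₂, hz₂, rfl⟩, ?_⟩
    · calc ‖z₁ + (v : ℂ)‖ ≤ ‖z₁‖ + ‖(v : ℂ)‖ := norm_add_le _ _
        _ ≤ ρ := by rw [hnv]; linarith
    · have h := norm_sub_norm_le z₂ (-(v : ℂ))
      rw [sub_neg_eq_add, norm_neg, hnv] at h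
      linarith
  -- the perturbed collection
  refine ⟨L ⊔ {c'}, Or.inr ⟨CurveClass.mk γ, ?_, c', ?_, hne, hcross, hcross'⟩, ?_⟩
  · show CurveClass.mk γ ∈ ((L ⊔ {c'} : LoopSpace ℂ) : Set (CurveClass ℂ))
    rw [TopologicalSpace.Closeds.coe_sup]; exact Or.inl hc
  · show c' ∈ ((L ⊔ {c'} : LoopSpace ℂ) : Set (CurveClass ℂ))
    rw [TopologicalSpace.Closeds.coe_sup]; exact Or.inr rfl
  -- its distance to `L` is at most `dist c' c ≤ v < η`
  have hdist : dist c' (CurveClass.mk γ) ≤ v := by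
    rw [hc', CurveClass.map_mk, CurveClass.dist_mk_mk]
    refine (Curve.dist_le_dist_toContinuousMap _ _).trans ((ContinuousMap.dist_le hvpos.le).2 fun t ↦ ?_)
    show dist ((γ.map f) t) (γ t) ≤ v
    rw [Curve.map_apply, dist_eq_norm]
    show ‖γ t + (v : ℂ) - γ t‖ ≤ v
    rw [add_sub_cancel_left, hnv]
  rw [TopologicalSpace.Closeds.edist_eq, TopologicalSpace.Closeds.coe_sup]
  refine lt_of_le_of_lt (Metric.hausdorffEDist_le_of_mem_edist (r := ENNReal.ofReal v) ?_ ?_) ?_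
  · intro x hx
    exact ⟨x, Or.inl hx, by rw [edist_self]; exact bot_le⟩
  · rintro x (hx | hx)
    · exact ⟨x, hx, by rw [edist_self]; exact bot_le⟩
    · refine ⟨CurveClass.mk γ, hc, ?_⟩
      rw [show x = c' from hx, edist_dist]
      exact ENNReal.ofReal_le_ofReal hdist
  · exact (ENNReal.ofReal_le_ofReal (by linarith)).trans_lt hηε

end Literature.Probability.Percolation
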